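import Literature.MathematicalPhysics.QuantumChemistry.OneBodyRelaxationExactness
import Literature.MathematicalPhysics.QuantumChemistry.WeinholdWilsonInequalities
import Literature.MathematicalPhysics.QuantumChemistry.SlaterCondonRulesMolecular
import Literature.MathematicalPhysics.QuantumLattice.FreeFermionGraphSectorFloor
import HarnessLib

/-!
# Ventures/CertifiedQuantumChemistry — Rows/OneBodySectorFermiSum.lean: the pair-level bathtub bound
# and the closed form of the `S_z`-SECTOR DQG programme of a one-body Hamiltonian

HONEST FRAMING (verbatim): certified bounds for a stated model Hamiltonian in a stated basis; not a
claim about the real molecule beyond that model.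

Seat rdm-B, ROWS courtesy file (theorems only; no `def`, no notation); part 1 of 2 (part 2:
`Rows/OneBodySectorExactness.lean`). The cell's lower rows are values / certified bounds of the
`S_z`-SECTOR programmes `IsDQGFeasibleSector a b` (`VariationalRDMRelaxation.lean`; optimal value
`pqgSectorEnergy`, `RelaxationEnergyHierarchy.lean`), whose exact counterpart is
`sectorGroundEnergy Ĥ a b`. `OneBodyRelaxationExactness.lean` proved that the `N`-ELECTRON programme
has no relaxation gap when `Ĥ` has no two-body part (Coleman's theorem); that does not give the
sector statement (`E₀(Ĥ; a, b)` exceeds `E₀(Ĥ; a + b)` in general, e.g. `(2, 0)` vs `(1, 1)`). The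
sector statement follows from the dual (bathtub / Pauli) route of Mazziotti (2007) ch. 3 §II.E.3
class (i) ("the 2-positivity conditions … are sufficient to compute the exact ground-state energy" of
"all one-particle Hamiltonians") carried out species by species in the `S_z` blocks of §II.F:

* `molecularHamiltonian_zero_eq_dGamma` — `Ĥ(h, 0, h_nuc) = dΓ(h ⊗ 1₂) + h_nuc` (`spinFreeOne`);
* **`fermiSum_le_re_oneBodyTerm`** — THE PAIR-LEVEL BATHTUB BOUND: for ANY one-matrix `γ` on the
  spin orbitals with `γ ⪰ 0`, `1 − γ ⪰ 0`, `Tr γ_αα = a`, `Tr γ_ββ = b`, and any complete orthonormal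
  eigenbasis `(v_k, ε_k)` of the one-electron matrix with Fermi sets `F↑` (`a` lowest levels), `F↓`
  (`b` lowest): `Σ_{F↑} ε + Σ_{F↓} ε ≤ Re Σ_pq h_pq Σ_σ γ^{pσ}_{qσ}` — the rotated occupations
  `n_{kσ} = Σ_ij w_{kσ}(i) γ_ij conj(w_{kσ}(j))` lie in `[0, 1]` and sum to `a` resp. `b` per species
  (Lieb–Loss Thm 1.14, the tree's `sum_fermiSet_le`);
* `fermiSea_oneBody` — the two-spin Fermi sea is a unit vector of the sector `(a, b)` and an
  eigenvector of `Ĥ(h, 0, h_nuc)` with eigenvalue `Σ_{F↑} ε + Σ_{F↓} ε + h_nuc`;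
* `fermiSum_le_re_rdmEnergy_oneBody` — every pair of `IsDQGFeasibleSector |F↑| |F↓|` lies above
  `Σ_{F↑} ε + Σ_{F↓} ε + Re h_nuc` (`γ ⪰ 0`: #17; `1 − γ ⪰ 0` in EVERY rank: the typer's
  `one_sub_one_posSemidef'`; the sector traces);
* **`sectorGroundEnergy_oneBody_eq_fermiSum`**, **`pqgSectorEnergy_oneBody_eq_fermiSum`** — CLOSED
  FORMS: for a one-body `Ĥ` BOTH the exact sector energy AND the optimal value of the sector DQG
  programme equal `Σ_{F↑} ε + Σ_{F↓} ε + Re h_nuc` (the cell's "free-fermion oracle" in kernel form: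
  an exact end-to-end test value for every sector SDP instance with the two-body part zeroed).

Everything is PROVED (0 sorry, standard axioms); no definitions, no named facts. NOT claimed: anything
about `g ≠ 0` (the gap is non-zero in general); attainment in general (`RelaxationEnergyAttained`).

References: D. A. Mazziotti, in *Reduced-Density-Matrix Mechanics*, Adv. Chem. Phys. 134 (Wiley 2007)
ch. 3 §II.E.3 (class (i): one-particle Hamiltonians), §II.F (`S_z` blocks) (held copy
`book:editornd-reduced-density-matrix-mechanics` PDF pp. 45, 47–48); E. H. Lieb, M. Loss, *Analysis*
(AMS 2001) Thm 1.14 (bathtub); J. Bardeen, L. N. Cooper, J. R. Schrieffer, Phys. Rev. 108 (1957)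
1175 §II (Fermi sea); T. Helgaker, P. Jørgensen, J. Olsen (2000) eqs. (1.4.39), (2.2.13).

Tree (REUSED): `spinFreeOne(_orb)`, `molecularHamiltonian_eq_dGamma_add_twoElectronOp`,
`twoElectronOp_spinFreeTwo` (`SlaterCondonRulesMolecular`); `spinMode_complete/orthonormal/unit/eigen`,
`dGamma_mulVec_slater`, `star_slater_dotProduct_self`, `isInSector_slater_spinMode`
(`FreeFermionSlaterModes`, `FreeFermionGraphSectorFloor`); `sum_fermiSet_le`
(`FreeFermionSectorEnergyDeviation`); `HubbardBandBottom.apply_eq_sum_eigenmodes`; `sum_orb_eq_sum_sum`;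
`IsDQGFeasible.one_posSemidef`, `IsDQGFeasibleSector.one_sub_one_posSemidef'`
(`WeinholdWilsonInequalities`); `rdmEnergy_oneBody`; `pqgSectorEnergy`, `pqgSectorEnergy_le_rdmEnergy`;
`rdmEnergy_rdm`, `IsDQGFeasibleSector.of_state`, `sectorGroundEnergy_le_of_rayleigh`,
`molecularHamiltonian_isHermitian`, `mem_szSector_iff_isInSector`. Mathlib:
`Matrix.PosSemidef.dotProduct_mulVec_nonneg`, `Matrix.smul_mulVec`, `le_csInf`.
-/

noncomputable section

namespace Summit.Ventures.CertifiedQuantumChemistry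

open Matrix Finset
open Literature.MathematicalPhysics.QuantumLattice Literature.MathematicalPhysics.QuantumChemistry
  Literature.MathematicalPhysics.QuantumLattice.RayleighBound
  Literature.MathematicalPhysics.QuantumLattice.HubbardBandBottom
open scoped ComplexOrder

variable {Λ : Type*} [LinearOrder Λ] [Fintype Λ] {κ : Type*}

/-! ### The one-body molecular Hamiltonian is `dΓ(h ⊗ 1₂) + h_nuc` -/

/-- Without two-body part the molecular Hamiltonian is the second quantisation of the spin-doubled
one-electron matrix plus the constant: `Ĥ(h, 0, h_nuc) = dΓ(spinFreeOne h) + h_nuc · 1`.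
Helgaker–Jørgensen–Olsen (2000) eq. (1.4.39) at `g = 0`. -/
theorem molecularHamiltonian_zero_eq_dGamma (h : Λ → Λ → ℂ) (hnuc : ℂ) :
    molecularHamiltonian h 0 hnuc =
      dGamma (spinFreeOne h) + hnuc • (1 : Matrix (Finset (Orb Λ)) (Finset (Orb Λ)) ℂ) := by
  rw [molecularHamiltonian_eq_dGamma_add_twoElectronOp, twoElectronOp_spinFreeTwo]
  simp only [Pi.zero_apply, zero_smul, Finset.sum_const_zero, smul_zero, add_zero]

/-- For Hermitian one-electron integrals and a real constant the one-body Hamiltonian is Hermitian.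
Helgaker–Jørgensen–Olsen (2000) eq. (2.2.13). -/
theorem molecularHamiltonian_zero_isHermitian {h : Λ → Λ → ℂ} {hnuc : ℂ}
    (hh : ∀ p q, star (h p q) = h q p) (hn : star hnuc = hnuc) :
    (molecularHamiltonian h 0 hnuc).IsHermitian :=
  molecularHamiltonian_isHermitian hh (fun _ _ _ _ => by simp) hn

omit [LinearOrder Λ] [Fintype Λ] in
/-- Hermitian one-electron integrals give a Hermitian one-electron matrix `Matrix.of h`. -/
theorem isHermitian_of_integrals {h : Λ → Λ → ℂ} (hh : ∀ p q, star (h p q) = h q p) :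
    (Matrix.of h).IsHermitian := by
  ext i j
  simp only [conjTranspose_apply, Matrix.of_apply]
  exact hh j i

/-! ### The pair-level bathtub bound -/

section Bathtub

variable [Fintype κ]

omit [LinearOrder Λ] [Fintype κ] in
/-- The spin-free one-body part of the energy functional is the spin-orbital contraction
`Σ_pq h_pq Σ_σ γ^{pσ}_{qσ} = Σ_{ij} (spinFreeOne h)_{ij} γ_{ij}`. -/
theorem oneBodyTerm_eq_sum_spinFreeOne (h : Λ → Λ → ℂ) (γ : Matrix (Orb Λ) (Orb Λ) ℂ) :
    ∑ p, ∑ q, h p q * ∑ σ : Fin 2, γ (orb p σ) (orb q σ) = ∑ i, ∑ j, spinFreeOne h i j * γ i j := by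
  rw [sum_orb_eq_sum_sum]
  refine Finset.sum_congr rfl fun p _ => ?_
  simp only [sum_orb_eq_sum_sum, spinFreeOne_orb, ite_mul, zero_mul, Finset.sum_ite_eq,
    Finset.mem_univ, if_true, Finset.mul_sum]
  rw [Finset.sum_comm]

/-- **The pair-level bathtub bound.** Let `(v_k, ε_k)` be a complete orthonormal eigenbasis of the
one-electron matrix (`Matrix.of h · v_k = ε_k v_k`), `F↑`, `F↓` Fermi sets of the levels (`≤ e_F`
inside, `≥ e_F` outside), and `γ` a one-matrix on the spin orbitals with `γ ⪰ 0`, `1 − γ ⪰ 0`,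
`Tr γ_αα = |F↑|`, `Tr γ_ββ = |F↓|`. Then `Σ_{F↑} ε + Σ_{F↓} ε ≤ Re Σ_pq h_pq Σ_σ γ^{pσ}_{qσ}`:
the rotated occupations `n_{kσ} = Σ_ij w_{kσ}(i) γ_ij conj(w_{kσ}(j))` lie in `[0, 1]` and sum to the
species numbers. Mazziotti (2007) §II.E.3 class (i) / §II.F; Lieb–Loss (2001) Thm 1.14. -/
theorem fermiSum_le_re_oneBodyTerm [DecidableEq κ] (h : Λ → Λ → ℂ) (v : κ → Λ → ℂ) (e : κ → ℝ)
    (hv : ∀ x y : Λ, ∑ k, v k x * star (v k y) = if x = y then 1 else 0)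
    (hon : ∀ k l, star (v k) ⬝ᵥ v l = if k = l then 1 else 0)
    (heig : ∀ k, Matrix.of h *ᵥ v k = ((e k : ℝ) : ℂ) • v k)
    (Fu Fd : Finset κ) (eu ed : ℝ)
    (hFu : ∀ k ∈ Fu, e k ≤ eu) (hFu' : ∀ k ∉ Fu, eu ≤ e k)
    (hFd : ∀ k ∈ Fd, e k ≤ ed) (hFd' : ∀ k ∉ Fd, ed ≤ e k)
    {γ : Matrix (Orb Λ) (Orb Λ) ℂ} (hγ : γ.PosSemidef) (hγ' : (1 - γ).PosSemidef)
    (hup : ∑ x, γ (orb x 0) (orb x 0) = Fu.card) (hdown : ∑ x, γ (orb x 1) (orb x 1) = Fd.card) :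
    ∑ k ∈ Fu, e k + ∑ k ∈ Fd, e k ≤ (∑ p, ∑ q, h p q * ∑ σ : Fin 2, γ (orb p σ) (orb q σ)).re := by
  classical
  set w : κ × Fin 2 → Orb Λ → ℂ := fun p o => if (ofLex o).2 = p.2 then v p.1 (ofLex o).1 else 0
    with hwdef
  have hw : ∀ p o, w p o = if (ofLex o).2 = p.2 then v p.1 (ofLex o).1 else 0 := fun p o => rfl
  have hGA : ∀ x σ y τ, spinFreeOne h (orb x σ) (orb y τ) = if σ = τ then Matrix.of h x y else 0 :=
    fun x σ y τ => by rw [spinFreeOne_orb, Matrix.of_apply]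
  -- the rotated occupation numbers of `γ`
  set n : κ × Fin 2 → ℂ := fun K => ∑ i, ∑ j, w K i * γ i j * star (w K j) with hndef
  -- (1) the one-body term is `Σ_K ε_K n_K`
  have h1 : ∑ p, ∑ q, h p q * ∑ σ : Fin 2, γ (orb p σ) (orb q σ) = ∑ K, (e K.1 : ℂ) * n K := by
    rw [oneBodyTerm_eq_sum_spinFreeOne]
    have hexp := apply_eq_sum_eigenmodes (spinFreeOne h) w (fun K => e K.1) (spinMode_complete v hv w hw)
      (spinMode_eigen (spinFreeOne h) hGA v e heig w hw)
    calc ∑ i, ∑ j, spinFreeOne h i j * γ i j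
        = ∑ i, ∑ j, ∑ K, (e K.1 : ℂ) * (w K i * γ i j * star (w K j)) := by
          refine Finset.sum_congr rfl fun i _ => Finset.sum_congr rfl fun j _ => ?_
          rw [hexp i j, Finset.sum_mul]
          refine Finset.sum_congr rfl fun K _ => ?_
          ring
      _ = ∑ i, ∑ K, ∑ j, (e K.1 : ℂ) * (w K i * γ i j * star (w K j)) :=
          Finset.sum_congr rfl fun _ _ => Finset.sum_comm
      _ = ∑ K, ∑ i, ∑ j, (e K.1 : ℂ) * (w K i * γ i j * star (w K j)) := Finset.sum_comm
      _ = ∑ K, (e K.1 : ℂ) * n K := by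
          refine Finset.sum_congr rfl fun K _ => ?_
          simp only [hndef, Finset.mul_sum]
  -- (2) each occupation is a diagonal value of `γ`: real, in `[0, 1]`
  have hquad : ∀ K, n K = star (star (w K)) ⬝ᵥ γ *ᵥ star (w K) := fun K => by
    simp only [hndef, dotProduct, mulVec, Pi.star_apply, star_star, Finset.mul_sum]
    refine Finset.sum_congr rfl fun i _ => Finset.sum_congr rfl fun j _ => ?_
    ring
  have hnorm : ∀ K, star (star (w K)) ⬝ᵥ star (w K) = 1 := fun K => by
    have hu := spinMode_unit v hon w hw K
    rw [dotProduct] at hu ⊢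
    simp only [Pi.star_apply, star_star] at hu ⊢
    rw [← hu]
    exact Finset.sum_congr rfl fun i _ => mul_comm _ _
  have hn0 : ∀ K, 0 ≤ n K := fun K => by
    rw [hquad]
    exact hγ.dotProduct_mulVec_nonneg _
  have hn1 : ∀ K, n K ≤ 1 := fun K => by
    have h0 := hγ'.dotProduct_mulVec_nonneg (star (w K))
    rw [sub_mulVec, dotProduct_sub, one_mulVec, hnorm, ← hquad, sub_nonneg] at h0
    exact h0
  have hre0 : ∀ K, 0 ≤ (n K).re := fun K => (Complex.nonneg_iff.1 (hn0 K)).1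
  have hre1 : ∀ K, (n K).re ≤ 1 := fun K => by
    have := (Complex.le_def.1 (hn1 K)).1
    simpa using this
  have him : ∀ K, (n K).im = 0 := fun K => ((Complex.nonneg_iff.1 (hn0 K)).2).symm
  -- (3) per species the occupations sum to the species trace
  have hnσ : ∀ (k : κ) (σ : Fin 2),
      n (k, σ) = ∑ x, ∑ y, v k x * γ (orb x σ) (orb y σ) * star (v k y) := by
    intro k σ
    simp only [hndef]
    rw [sum_orb_eq_sum_sum]
    refine Finset.sum_congr rfl fun x _ => ?_
    rw [Finset.sum_eq_single σ (fun τ _ hτ => Finset.sum_eq_zero fun j _ => by simp [hw, hτ])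
      (fun h => absurd (Finset.mem_univ σ) h), sum_orb_eq_sum_sum]
    refine Finset.sum_congr rfl fun y _ => ?_
    rw [Finset.sum_eq_single σ (fun ρ _ hρ => by simp [hw, hρ]) (fun h => absurd (Finset.mem_univ σ) h)]
    simp [hw]
  have hsumσ : ∀ σ : Fin 2, ∑ k, n (k, σ) = ∑ x, γ (orb x σ) (orb x σ) := by
    intro σ
    simp only [hnσ]
    calc ∑ k, ∑ x, ∑ y, v k x * γ (orb x σ) (orb y σ) * star (v k y)
        = ∑ x, ∑ k, ∑ y, v k x * γ (orb x σ) (orb y σ) * star (v k y) := Finset.sum_comm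
      _ = ∑ x, ∑ y, ∑ k, v k x * γ (orb x σ) (orb y σ) * star (v k y) :=
          Finset.sum_congr rfl fun _ _ => Finset.sum_comm
      _ = ∑ x, ∑ y, γ (orb x σ) (orb y σ) * ∑ k, v k x * star (v k y) := by
          refine Finset.sum_congr rfl fun x _ => Finset.sum_congr rfl fun y _ => ?_
          rw [Finset.mul_sum]
          refine Finset.sum_congr rfl fun k _ => ?_
          ring
      _ = ∑ x, γ (orb x σ) (orb x σ) := by
          refine Finset.sum_congr rfl fun x _ => ?_
          simp only [hv, mul_ite, mul_one, mul_zero, Finset.sum_ite_eq, Finset.mem_univ, if_true]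
  have hsum_re : ∀ (σ : Fin 2) (F : Finset κ), ∑ x, γ (orb x σ) (orb x σ) = (F.card : ℂ) →
      ∑ k, (n (k, σ)).re = F.card := by
    intro σ F hF
    rw [← Complex.re_sum, hsumσ σ, hF, Complex.natCast_re]
  -- (4) assemble: `Re Σ_K ε_K n_K = Σ_σ Σ_k ε_k Re n_{kσ} ≥ Σ_{F↑} ε + Σ_{F↓} ε`
  rw [h1, Complex.re_sum]
  simp only [Complex.re_ofReal_mul]
  rw [Fintype.sum_prod_type_right, Fin.sum_univ_two]
  exact add_le_add
    (sum_fermiSet_le e (fun k => (n (k, 0)).re) Fu eu hFu hFu' (fun k => hre0 _) (fun k => hre1 _)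
      (hsum_re 0 Fu hup))
    (sum_fermiSet_le e (fun k => (n (k, 1)).re) Fd ed hFd hFd' (fun k => hre0 _) (fun k => hre1 _)
      (hsum_re 1 Fd hdown))

end Bathtub

/-! ### The two-spin Fermi sea and the closed forms -/

section FermiSea

variable [Fintype κ] [DecidableEq κ]

omit [Fintype κ] in
/-- **The two-spin Fermi sea of a one-body molecular Hamiltonian.** For orthonormal eigenmodes
`(v_k, ε_k)` of `Matrix.of h` and finite sets `F↑`, `F↓` of modes, the Slater state filling the
`↑`-modes of `F↑` and the `↓`-modes of `F↓` lies in the sector `(|F↑|, |F↓|)`, is a unit vector, and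
`Ĥ(h, 0, h_nuc) Φ = (Σ_{F↑} ε + Σ_{F↓} ε + h_nuc) Φ`. Bardeen–Cooper–Schrieffer (1957) §II;
Bratteli–Robinson II §5.2.1 (cf. the tree's `fermiSea_spec` for the Hubbard `H(0)`). -/
theorem fermiSea_oneBody (h : Λ → Λ → ℂ) (hnuc : ℂ) (v : κ → Λ → ℂ) (e : κ → ℝ)
    (hon : ∀ k l, star (v k) ⬝ᵥ v l = if k = l then 1 else 0)
    (heig : ∀ k, Matrix.of h *ᵥ v k = ((e k : ℝ) : ℂ) • v k)
    (w : κ × Fin 2 → Orb Λ → ℂ) (hw : ∀ p o, w p o = if (ofLex o).2 = p.2 then v p.1 (ofLex o).1 else 0)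
    (Fu Fd : Finset κ) (Φ : Fock (Orb Λ))
    (hΦ : Φ = (List.map (fun p => create (w p))
      (List.map (fun k => Prod.mk k (0 : Fin 2)) Fu.toList ++
        List.map (fun k => Prod.mk k (1 : Fin 2)) Fd.toList)).prod *ᵥ vacuum) :
    IsInSector Fu.card Fd.card Φ ∧ star Φ ⬝ᵥ Φ = 1 ∧
      molecularHamiltonian h 0 hnuc *ᵥ Φ = (((∑ k ∈ Fu, e k + ∑ k ∈ Fd, e k : ℝ) : ℂ) + hnuc) • Φ := by
  have hGA : ∀ x σ y τ, spinFreeOne h (orb x σ) (orb y τ) = if σ = τ then Matrix.of h x y else 0 :=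
    fun x σ y τ => by rw [spinFreeOne_orb, Matrix.of_apply]
  subst hΦ
  refine ⟨?_, ?_, ?_⟩
  · have hs := isInSector_slater_spinMode v w hw Fu.toList Fd.toList
    rwa [Finset.length_toList, Finset.length_toList] at hs
  · refine star_slater_dotProduct_self w (spinMode_orthonormal v hon w hw) ?_
    rw [List.nodup_append']
    refine ⟨Fu.nodup_toList.map fun a b h => (Prod.mk.inj h).1,
      Fd.nodup_toList.map fun a b h => (Prod.mk.inj h).1, fun p hp hp' => ?_⟩
    rw [List.mem_map] at hp hp'
    obtain ⟨k, -, rfl⟩ := hp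
    obtain ⟨k', -, hk'⟩ := hp'
    exact absurd (Prod.mk.inj hk').2 (by decide)
  · have hsum : (((List.map (fun k => Prod.mk k (0 : Fin 2)) Fu.toList ++
        List.map (fun k => Prod.mk k (1 : Fin 2)) Fd.toList).map fun p => e p.1).sum : ℝ) =
        ∑ k ∈ Fu, e k + ∑ k ∈ Fd, e k := by
      rw [List.map_append, List.sum_append, List.map_map, List.map_map]
      change (Fu.toList.map e).sum + (Fd.toList.map e).sum = _
      rw [Finset.sum_map_toList, Finset.sum_map_toList]
    rw [molecularHamiltonian_zero_eq_dGamma, add_mulVec, smul_mulVec, one_mulVec, add_smul,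
      dGamma_mulVec_slater (spinFreeOne h) w (fun p => e p.1)
        (spinMode_eigen (spinFreeOne h) hGA v e heig w hw), hsum]

omit [Fintype κ] in
/-- The Fermi sea bounds the exact sector energy from above:
`E₀(Ĥ(h, 0, h_nuc); |F↑|, |F↓|) ≤ Σ_{F↑} ε + Σ_{F↓} ε + Re h_nuc` (Rayleigh–Ritz in the sector).
Bardeen–Cooper–Schrieffer (1957) §II. -/
theorem sectorGroundEnergy_oneBody_le_fermiSum {h : Λ → Λ → ℂ} {hnuc : ℂ}
    (hh : ∀ p q, star (h p q) = h q p) (hn : star hnuc = hnuc) (v : κ → Λ → ℂ) (e : κ → ℝ)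
    (hon : ∀ k l, star (v k) ⬝ᵥ v l = if k = l then 1 else 0)
    (heig : ∀ k, Matrix.of h *ᵥ v k = ((e k : ℝ) : ℂ) • v k) (Fu Fd : Finset κ) :
    sectorGroundEnergy (molecularHamiltonian h 0 hnuc) Fu.card Fd.card ≤
      ∑ k ∈ Fu, e k + ∑ k ∈ Fd, e k + hnuc.re := by
  set w : κ × Fin 2 → Orb Λ → ℂ := fun p o => if (ofLex o).2 = p.2 then v p.1 (ofLex o).1 else 0
    with hwdef
  obtain ⟨hsec, h1, hH⟩ := fermiSea_oneBody h hnuc v e hon heig w (fun p o => rfl) Fu Fd _ rfl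
  refine sectorGroundEnergy_le_of_rayleigh (molecularHamiltonian_zero_isHermitian hh hn) hsec
    (fun h0 => zero_ne_one (by rw [h0, dotProduct_zero] at h1; exact h1)) ?_
  rw [hH, dotProduct_smul, h1, smul_eq_mul, mul_one, Complex.one_re, mul_one, Complex.add_re,
    Complex.ofReal_re]

/-- **Every sector-feasible pair lies above the Fermi sum**: with a complete orthonormal eigenbasis
`(v_k, ε_k)` of `Matrix.of h` and Fermi sets `F↑`, `F↓`, every `(γ, Γ)` of
`IsDQGFeasibleSector |F↑| |F↓|` has `Σ_{F↑} ε + Σ_{F↓} ε + Re h_nuc ≤ Re E_{h,0,h_nuc}(γ, Γ)`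
(`γ ⪰ 0`: 2⇒1 positivity #17; `1 − γ ⪰ 0` in every rank: `one_sub_one_posSemidef'`; the sector
traces; then `fermiSum_le_re_oneBodyTerm`). Mazziotti (2007) §II.E.3 (i), §II.F. -/
theorem fermiSum_le_re_rdmEnergy_oneBody (h : Λ → Λ → ℂ) (hnuc : ℂ) (v : κ → Λ → ℂ) (e : κ → ℝ)
    (hv : ∀ x y : Λ, ∑ k, v k x * star (v k y) = if x = y then 1 else 0)
    (hon : ∀ k l, star (v k) ⬝ᵥ v l = if k = l then 1 else 0)
    (heig : ∀ k, Matrix.of h *ᵥ v k = ((e k : ℝ) : ℂ) • v k)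
    (Fu Fd : Finset κ) (eu ed : ℝ)
    (hFu : ∀ k ∈ Fu, e k ≤ eu) (hFu' : ∀ k ∉ Fu, eu ≤ e k)
    (hFd : ∀ k ∈ Fd, e k ≤ ed) (hFd' : ∀ k ∉ Fd, ed ≤ e k)
    {γ : Matrix (Orb Λ) (Orb Λ) ℂ} {Γ : Matrix (Orb Λ × Orb Λ) (Orb Λ × Orb Λ) ℂ}
    (hf : IsDQGFeasibleSector Fu.card Fd.card γ Γ) :
    ∑ k ∈ Fu, e k + ∑ k ∈ Fd, e k + hnuc.re ≤ (rdmEnergy h 0 hnuc γ Γ).re := by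
  rw [rdmEnergy_oneBody, Complex.add_re]
  exact add_le_add (fermiSum_le_re_oneBodyTerm h v e hv hon heig Fu Fd eu ed hFu hFu' hFd hFd'
    hf.dqg.one_posSemidef hf.one_sub_one_posSemidef' hf.trace_up hf.trace_down) le_rfl

/-- **CLOSED FORM of the exact sector energy of a one-body Hamiltonian**: for Hermitian `h`, real
`h_nuc`, a complete orthonormal eigenbasis `(v_k, ε_k)` and Fermi sets `F↑`, `F↓`:
`E₀(Ĥ(h, 0, h_nuc); |F↑|, |F↓|) = Σ_{F↑} ε + Σ_{F↓} ε + Re h_nuc` (the free sector floor is the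
two-species Fermi sum; cf. `minEnergyOn_szSector_hamiltonian_zero_eq_fermiSum` for Hubbard graphs).
Bardeen–Cooper–Schrieffer (1957) §II; Lieb–Loss (2001) Thm 1.14. -/
theorem sectorGroundEnergy_oneBody_eq_fermiSum {h : Λ → Λ → ℂ} {hnuc : ℂ}
    (hh : ∀ p q, star (h p q) = h q p) (hn : star hnuc = hnuc) (v : κ → Λ → ℂ) (e : κ → ℝ)
    (hv : ∀ x y : Λ, ∑ k, v k x * star (v k y) = if x = y then 1 else 0)
    (hon : ∀ k l, star (v k) ⬝ᵥ v l = if k = l then 1 else 0)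
    (heig : ∀ k, Matrix.of h *ᵥ v k = ((e k : ℝ) : ℂ) • v k)
    (Fu Fd : Finset κ) (eu ed : ℝ)
    (hFu : ∀ k ∈ Fu, e k ≤ eu) (hFu' : ∀ k ∉ Fu, eu ≤ e k)
    (hFd : ∀ k ∈ Fd, e k ≤ ed) (hFd' : ∀ k ∉ Fd, ed ≤ e k) :
    sectorGroundEnergy (molecularHamiltonian h 0 hnuc) Fu.card Fd.card =
      ∑ k ∈ Fu, e k + ∑ k ∈ Fd, e k + hnuc.re := by
  refine le_antisymm (sectorGroundEnergy_oneBody_le_fermiSum hh hn v e hon heig Fu Fd) ?_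
  set w : κ × Fin 2 → Orb Λ → ℂ := fun p o => if (ofLex o).2 = p.2 then v p.1 (ofLex o).1 else 0
    with hwdef
  obtain ⟨hsec, h1, -⟩ := fermiSea_oneBody h hnuc v e hon heig w (fun p o => rfl) Fu Fd _ rfl
  rw [sectorGroundEnergy_def, Matrix.minEnergyOn]
  refine le_csInf ⟨_, _, (mem_szSector_iff_isInSector _ _ _).2 hsec, h1, rfl⟩ ?_
  rintro E ⟨ψ, hψ, hψ1, rfl⟩
  rw [← rdmEnergy_rdm h 0 hnuc hψ1]
  exact fermiSum_le_re_rdmEnergy_oneBody h hnuc v e hv hon heig Fu Fd eu ed hFu hFu' hFd hFd'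
    (IsDQGFeasibleSector.of_state ((mem_szSector_iff_isInSector _ _ ψ).1 hψ) hψ1)

/-- **CLOSED FORM of the optimal value of the sector DQG programme of a one-body Hamiltonian** (the
free-fermion oracle in kernel form): with the data of `sectorGroundEnergy_oneBody_eq_fermiSum`
(no Hermiticity hypothesis is even needed — the eigen-data carry it),
`E_PQG(h, 0, h_nuc; |F↑|, |F↓|) = Σ_{F↑} ε + Σ_{F↓} ε + Re h_nuc`: attained at the Fermi sea's
reduced density matrices, and a lower bound of the functional on the whole sector-feasible set.
Mazziotti (2007) §II.E.3 (i), §II.F. -/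
theorem pqgSectorEnergy_oneBody_eq_fermiSum (h : Λ → Λ → ℂ) (hnuc : ℂ) (v : κ → Λ → ℂ) (e : κ → ℝ)
    (hv : ∀ x y : Λ, ∑ k, v k x * star (v k y) = if x = y then 1 else 0)
    (hon : ∀ k l, star (v k) ⬝ᵥ v l = if k = l then 1 else 0)
    (heig : ∀ k, Matrix.of h *ᵥ v k = ((e k : ℝ) : ℂ) • v k)
    (Fu Fd : Finset κ) (eu ed : ℝ)
    (hFu : ∀ k ∈ Fu, e k ≤ eu) (hFu' : ∀ k ∉ Fu, eu ≤ e k)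
    (hFd : ∀ k ∈ Fd, e k ≤ ed) (hFd' : ∀ k ∉ Fd, ed ≤ e k) :
    pqgSectorEnergy h 0 hnuc Fu.card Fd.card = ∑ k ∈ Fu, e k + ∑ k ∈ Fd, e k + hnuc.re := by
  set w : κ × Fin 2 → Orb Λ → ℂ := fun p o => if (ofLex o).2 = p.2 then v p.1 (ofLex o).1 else 0
    with hwdef
  obtain ⟨hsec, h1, hH⟩ := fermiSea_oneBody h hnuc v e hon heig w (fun p o => rfl) Fu Fd _ rfl
  refine le_antisymm ?_ ?_
  · have hle := pqgSectorEnergy_le_rdmEnergy h 0 hnuc (IsDQGFeasibleSector.of_state hsec h1)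
    rwa [rdmEnergy_rdm h 0 hnuc h1, hH, dotProduct_smul, h1, smul_eq_mul, mul_one, Complex.add_re,
      Complex.ofReal_re] at hle
  · rw [pqgSectorEnergy]
    refine le_csInf ⟨_, _, _, IsDQGFeasibleSector.of_state hsec h1, rfl⟩ ?_
    rintro E ⟨γ, Γ, hf, rfl⟩
    exact fermiSum_le_re_rdmEnergy_oneBody h hnuc v e hv hon heig Fu Fd eu ed hFu hFu' hFd hFd' hf

end FermiSea

end Summit.Ventures.CertifiedQuantumChemistry

end
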